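import Summits.QuantumFields.YangMills.Theorems.BalabanUVNodesN15TwoSpacingGluingCommutator
import HarnessLib

/-!
# THE GLUING STEP AT TWO LATTICE SPACINGS, VI: the (3.42) ENTRIES of the glued propagator from CUBE ENTRIES — the left-dressed parametrix `D∘G₀` and the
# right-dressed one `G₀∘E` expanded over the cubes by the lattice Leibniz rules (`∇M_h = M_{h∘e}∇ + M_{∇h}`, `M_h∇* = ∇*M_{h∘e} + M_{∇h}`), their bounded-overlap majorants
# and η-defects from the cubes' entries 0∕1∕2 and the partition's letters — the inputs of FILE 44's `hasMaj_idef_comp_glueInv` ∕ `hasMaj_idef_glueInvL_comp`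
# (dag-n15-c g11, FILE 48; N15 = NE2, s1 «background-layer OPERATOR ingredient»)

Cell `pub-ymgap`, seat `pub-ymgap-dag-n15-c` (R134 (a); HUMAN RULING D-0062), generation 11.  `bears_on: R4∕N15 · K3⁷ SpineGivenEndpointR13SepCoPH (stmt-QuantumFields-20544)`.
Filed `--supports stmt-QuantumFields-20544 --as helper` — COUNT-NEUTRAL.  Theorems only (0 `def`, 0 `sorry`).  Imports BY NAME FILE 46 `…N15TwoSpacingGluingCommutator` (through it FILES
43–45: `parametrix`, `hasMaj_diag_comp`, `hasMaj_comp_diag`, `hasMaj_sum_overlap`, `idef_fsum`, `idef_sandwich`; g8 FILE 1 `fgrad`∕`bgrad`∕`fgradAdj`∕`mulOp_comp_fgradAdj`; lit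
`T4EtaRateCoeffDefect.hasMaj_mulOp`∕`hasMaj_idef_mulOp`, `B6Prop26Gluing.mulOp`∕`ind`); nothing in the tree is modified.

WHY.  FILE 44 bounds the η-defect of the glued propagator's (3.42) entries with LEFT factors (`D∘G = (D∘G₀)∘N`, entries 1, 3) and RIGHT factors (`G∘E = Ñ∘(G₀∘E)`, entry 2) from
the majorant and η-defect of the DRESSED parametrices `D∘G₀`, `G₀∘E`; FILE 45 expanded the bare parametrix over the cubes.  [Balaban1984PropagatorsII] Prop. 2.6 (2.136) p. 247 lists the
entries `|GJ|, |∇GJ|, …` of the glued operator and obtains them from the cubes' (2.133) by the same Leibniz bookkeeping.  THIS FILE expands the dressed parametrices over the cubes for ANY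
first-order `D`, `E` obeying a Leibniz rule against multiplications (`D∘M_h = M_{h^s}∘D + M_{dh}`, `M_h∘E = E∘M_{h^s} + M_{dh}` — instances: `fgrad_comp_mulOp`, `bgrad_comp_mulOp`, FILE 1's
`mulOp_comp_fgradAdj`), so that only the cubes' entries appear: `D∘G₀ = Σ_□[M_{h^s}∘(D∘G_□)∘M_h + M_{dh}∘G_□∘M_h]`, `G₀∘E = Σ_□[M_h∘(G_□∘E)∘M_{h^s} + M_h∘G_□∘M_{dh}]`.
* §1 Leibniz instances `fgrad_comp_mulOp`, `bgrad_comp_mulOp`; ★ `comp_parametrix_of_leibniz`, ★ `parametrix_comp_of_leibniz`;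
* §2 `hasMaj_sandwich_loc` (general coefficient bounds), ★★ `hasMaj_comp_parametrix` (`D∘G₀ ≤ N_ov(c_sβ₁ + c_dβ)e^{−δd}`), ★★ `hasMaj_parametrix_comp` (`G₀∘E ≤ N_ov(β₂c_s + βc_d)e^{−δd}`);
* §3 `hasMaj_idef_sandwich_loc` (Leibniz for the η-defect of a sandwich with general coefficient letters), ★★ `hasMaj_idef_comp_parametrix`, ★★ `hasMaj_idef_parametrix_comp` — the η-defects
  from the cubes' entry defects (`m₀`, `m₁` resp. `m₂`), the partition's letters and fits (of `h`, of the shifted `h^s`, of `dh`).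

HONEST FRAMING ∕ LIMITS.  Lattice Leibniz + block-majorant bookkeeping ([B6] (2.91) p.239, (2.133)–(2.136) p.247 = MECHANISM; nothing of [B6]∕[B9] asserted).  DISPLAYED, located: the
cubes' entries 0∕1∕2 and their two-grid defects at both spacings (the lineage's perturbative device on Dirichlet cubes in the cube's (3.35) gauge — no tree producer), the partition's letters and
fits (the fit of the SHIFTED partition `h∘e` against `h′∘e′` is its own letter: the block pull-back does not intertwine one fine and one coarse step).  NE2⁺ NOT PRINTED, NOT proved; N15 NOT
discharged; counts of record UNMOVED (typed 28∕28 · discharged 5∕27); one finite 𝕋⁴ at fixed ε — NOT infinite volume, NOT OS on ℝ⁴, NOT a mass gap, NOT Clay; R4 closes the conditional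
finite-𝕋⁴ rung `BalabanLadder.UV` only.  Restate-immune (no Theses import).
-/

noncomputable section

namespace Summit.QuantumFields.YangMills.BalabanUVNodes.N15.Gluing

open Literature.MathematicalPhysics.QuantumFieldTheory.Balaban1983to89
open Literature.MathematicalPhysics.QuantumFieldTheory.Balaban1983to89.B11SectG (BlockNorm HasMaj)
open Literature.MathematicalPhysics.QuantumFieldTheory.Balaban1983to89.T4EtaRateDefect (idef idef_apply idef_comp idef_add)
open Literature.MathematicalPhysics.QuantumFieldTheory.Balaban1983to89.T4EtaRateCoeffDefect (pull pull_apply diagK diagK_nonneg hasMaj_mulOp hasMaj_idef_mulOp)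
open Literature.MathematicalPhysics.QuantumFieldTheory.Balaban1983to89.B6Prop26Gluing (mulOp mulOp_apply ind ind_nonneg ind_le_one)
open Summit.QuantumFields.YangMills.BalabanUVNodes.N15.BackgroundLayer (fgrad fgradAdj bgrad fgrad_apply fgradAdj_apply bgrad_apply mulOp_comp_fgradAdj)

/-! ## §1 Leibniz rules and the dressed parametrices expanded over the cubes -/

section Leibniz

variable {X : Type} {ι : Type} [Fintype ι]

omit [Fintype ι] in
/-- LATTICE LEIBNIZ, forward: `∇∘M_h = M_{h∘e}∘∇ + M_{∇h}` (`∇(hf)(x) = h(ex)∇f(x) + (∇h)(x)f(x)`). [cite: Balaban1984PropagatorsI, (1.2)–(1.3) p.18 (lattice derivatives: shape)] -/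
theorem fgrad_comp_mulOp (n : ℝ) (e : X ≃ X) (h : X → ℝ) : fgrad n e ∘ₗ mulOp h = mulOp (h ∘ e) ∘ₗ fgrad n e + mulOp (fgrad n e h) := by
  refine LinearMap.ext fun f => funext fun x => ?_
  simp only [LinearMap.comp_apply, LinearMap.add_apply, Pi.add_apply, fgrad_apply, mulOp_apply, Function.comp_apply]
  ring

omit [Fintype ι] in
/-- LATTICE LEIBNIZ, backward: `∇⁻∘M_h = M_{h∘e⁻¹}∘∇⁻ + M_{∇⁻h}`. [cite: Balaban1984PropagatorsI, (1.2)–(1.3) p.18 (shape)] -/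
theorem bgrad_comp_mulOp (n : ℝ) (e : X ≃ X) (h : X → ℝ) : bgrad n e ∘ₗ mulOp h = mulOp (h ∘ e.symm) ∘ₗ bgrad n e + mulOp (bgrad n e h) := by
  refine LinearMap.ext fun f => funext fun x => ?_
  simp only [LinearMap.comp_apply, LinearMap.add_apply, Pi.add_apply, bgrad_apply, mulOp_apply, Function.comp_apply]
  ring

/-- ★ **THE LEFT-DRESSED PARAMETRIX OVER THE CUBES**: for `D` with the Leibniz rule `D∘M_{h_□} = M_{h^s_□}∘D + M_{dh_□}`, `D∘G₀ = Σ_□[M_{h^s_□}∘(D∘G_□)∘M_{h_□} + M_{dh_□}∘G_□∘M_{h_□}]` — only the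
cube's entries `D∘G_□` and `G_□` appear. [cite: Balaban1984PropagatorsII, (2.136) p.247 (entries: mechanism)] -/
theorem comp_parametrix_of_leibniz {D : (X → ℝ) →ₗ[ℝ] (X → ℝ)} {h hs dh : ι → X → ℝ} {G : ι → (X → ℝ) →ₗ[ℝ] (X → ℝ)}
    (hleib : ∀ i, D ∘ₗ mulOp (h i) = mulOp (hs i) ∘ₗ D + mulOp (dh i)) :
    D ∘ₗ parametrix h G = ∑ i, (mulOp (hs i) ∘ₗ (D ∘ₗ G i) ∘ₗ mulOp (h i) + mulOp (dh i) ∘ₗ G i ∘ₗ mulOp (h i)) := by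
  have hsum : D ∘ₗ parametrix h G = ∑ i, D ∘ₗ (mulOp (h i) ∘ₗ G i ∘ₗ mulOp (h i)) :=
    LinearMap.ext fun v => by simp only [parametrix, LinearMap.comp_apply, LinearMap.coe_sum, Finset.sum_apply, map_sum]
  rw [hsum]
  refine Finset.sum_congr rfl fun i _ => ?_
  rw [← LinearMap.comp_assoc, hleib i, LinearMap.add_comp]
  simp only [LinearMap.comp_assoc]

/-- ★ **THE RIGHT-DRESSED PARAMETRIX OVER THE CUBES**: for `E` with `M_{h_□}∘E = E∘M_{h^s_□} + M_{dh_□}` (FILE 1's `mulOp_comp_fgradAdj` for `E = ∇*`), `G₀∘E = Σ_□[M_{h_□}∘(G_□∘E)∘M_{h^s_□} +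
M_{h_□}∘G_□∘M_{dh_□}]` — only the cube's entry `G_□∘E` and `G_□` appear. [cite: Balaban1984PropagatorsII, (2.136) p.247 (entries: mechanism)] -/
theorem parametrix_comp_of_leibniz {E : (X → ℝ) →ₗ[ℝ] (X → ℝ)} {h hs dh : ι → X → ℝ} {G : ι → (X → ℝ) →ₗ[ℝ] (X → ℝ)}
    (hleib : ∀ i, mulOp (h i) ∘ₗ E = E ∘ₗ mulOp (hs i) + mulOp (dh i)) :
    parametrix h G ∘ₗ E = ∑ i, (mulOp (h i) ∘ₗ (G i ∘ₗ E) ∘ₗ mulOp (hs i) + mulOp (h i) ∘ₗ G i ∘ₗ mulOp (dh i)) := by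
  have hsum : parametrix h G ∘ₗ E = ∑ i, (mulOp (h i) ∘ₗ G i ∘ₗ mulOp (h i)) ∘ₗ E :=
    LinearMap.ext fun v => by simp only [parametrix, LinearMap.comp_apply, LinearMap.coe_sum, Finset.sum_apply]
  rw [hsum]
  refine Finset.sum_congr rfl fun i _ => ?_
  rw [LinearMap.comp_assoc, LinearMap.comp_assoc, hleib i, LinearMap.comp_add, LinearMap.comp_add]
  simp only [LinearMap.comp_assoc]

end Leibniz

/-! ## §2 Majorants of the dressed parametrices from cube entries under bounded overlap -/

section Majorants

variable {X : Type} [Fintype X] {ι : Type} [Fintype ι] {g : B6.Geometry} (blk : X → g.Site) (S : ι → Set g.Site)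

/-- A sandwich `M_a∘T∘M_b` with `|a| ≤ c_a`, `|b| ≤ c_b`, `T ≤ 1_S1_S·βe^{−δd}` has `≤ 1_S1_S·c_aβc_b e^{−δd}`. [folklore] -/
theorem hasMaj_sandwich_loc {T : (X → ℝ) →ₗ[ℝ] (X → ℝ)} {a b : X → ℝ} {Sc : Set g.Site} {ca cb β δ : ℝ} (hca : 0 ≤ ca) (hcb : 0 ≤ cb) (hβ : 0 ≤ β)
    (ha : ∀ x, |a x| ≤ ca) (hb : ∀ x, |b x| ≤ cb)
    (hT : HasMaj (BlockNorm.ofBlocks g blk) (BlockNorm.ofBlocks g blk) T (fun y y' => ind Sc y * ind Sc y' * (β * Real.exp (-(δ * g.dist y y'))))) :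
    HasMaj (BlockNorm.ofBlocks g blk) (BlockNorm.ofBlocks g blk) (mulOp a ∘ₗ T ∘ₗ mulOp b) (fun y y' => ind Sc y * ind Sc y' * (ca * β * cb * Real.exp (-(δ * g.dist y y')))) := by
  have hMa := hasMaj_mulOp (g := g) blk (m := fun _ => ca) (fun _ => hca) ha
  have hMb := hasMaj_mulOp (g := g) blk (m := fun _ => cb) (fun _ => hcb) hb
  have hnn : ∀ y y' : g.Site, 0 ≤ ind Sc y * ind Sc y' * (β * Real.exp (-(δ * g.dist y y'))) :=
    fun y y' => mul_nonneg (mul_nonneg (ind_nonneg _ _) (ind_nonneg _ _)) (mul_nonneg hβ (Real.exp_nonneg _))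
  refine (hasMaj_diag_comp blk (fun _ => hca) hMa (hasMaj_comp_diag blk hnn hT hMb)).mono fun y y' => le_of_eq ?_
  ring

/-- One term of the overlap sum: `1_S(y)1_S(y′)·A ≤ 1_S(y)·A` for `A ≥ 0`. [folklore] -/
theorem ind_mul_ind_le {Sc : Set g.Site} {A : ℝ} (hA : 0 ≤ A) (y y' : g.Site) : ind Sc y * ind Sc y' * A ≤ ind Sc y * A := by
  have h1 := ind_le_one Sc y'
  have h0 : 0 ≤ ind Sc y * A := mul_nonneg (ind_nonneg _ _) hA
  calc ind Sc y * ind Sc y' * A = ind Sc y' * (ind Sc y * A) := by ring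
    _ ≤ 1 * (ind Sc y * A) := mul_le_mul_of_nonneg_right h1 h0
    _ = ind Sc y * A := one_mul _

/-- ★★ **THE LEFT-DRESSED PARAMETRIX DECAYS**: cube entries `D∘G_□ ≤ 1_S1_S·β₁e^{−δd}`, `G_□ ≤ 1_S1_S·βe^{−δd}`, partition letters `|h^s_□| ≤ c_s`, `|dh_□| ≤ c_d`, `|h_□| ≤ 1`, overlap `≤ N_ov`
⟹ `D∘G₀ ≤ N_ov·(c_sβ₁ + c_dβ)·e^{−δd}`. [cite: Balaban1984PropagatorsII, (2.133), (2.136) p.247 (shapes + mechanism)] -/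
theorem hasMaj_comp_parametrix {D : (X → ℝ) →ₗ[ℝ] (X → ℝ)} {h hs dh : ι → X → ℝ} {G : ι → (X → ℝ) →ₗ[ℝ] (X → ℝ)} {β β₁ cs cd δ Nov : ℝ}
    (hβ : 0 ≤ β) (hβ₁ : 0 ≤ β₁) (hcs : 0 ≤ cs) (hcd : 0 ≤ cd) (hleib : ∀ i, D ∘ₗ mulOp (h i) = mulOp (hs i) ∘ₗ D + mulOp (dh i))
    (hh : ∀ i x, |h i x| ≤ 1) (hhs : ∀ i x, |hs i x| ≤ cs) (hdh : ∀ i x, |dh i x| ≤ cd) (hN : ∀ a, ∑ i, ind (S i) a ≤ Nov)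
    (hG : ∀ i, HasMaj (BlockNorm.ofBlocks g blk) (BlockNorm.ofBlocks g blk) (G i) (fun y y' => ind (S i) y * ind (S i) y' * (β * Real.exp (-(δ * g.dist y y')))))
    (hDG : ∀ i, HasMaj (BlockNorm.ofBlocks g blk) (BlockNorm.ofBlocks g blk) (D ∘ₗ G i) (fun y y' => ind (S i) y * ind (S i) y' * (β₁ * Real.exp (-(δ * g.dist y y'))))) :
    HasMaj (BlockNorm.ofBlocks g blk) (BlockNorm.ofBlocks g blk) (D ∘ₗ parametrix h G) (fun y y' => Nov * (cs * β₁ + cd * β) * Real.exp (-(δ * g.dist y y'))) := by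
  have hterm : ∀ i, HasMaj (BlockNorm.ofBlocks g blk) (BlockNorm.ofBlocks g blk) (mulOp (hs i) ∘ₗ (D ∘ₗ G i) ∘ₗ mulOp (h i) + mulOp (dh i) ∘ₗ G i ∘ₗ mulOp (h i))
      (fun y y' => ind (S i) y * ((cs * β₁ + cd * β) * Real.exp (-(δ * g.dist y y')))) := fun i => by
    have t1 := hasMaj_sandwich_loc blk hcs zero_le_one hβ₁ (hhs i) (hh i) (hDG i)
    have t2 := hasMaj_sandwich_loc blk hcd zero_le_one hβ (hdh i) (hh i) (hG i)
    refine (t1.add t2).mono fun y y' => ?_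
    have key := ind_mul_ind_le (Sc := S i) (A := (cs * β₁ + cd * β) * Real.exp (-(δ * g.dist y y'))) (mul_nonneg (by positivity) (Real.exp_nonneg _)) y y'
    calc ind (S i) y * ind (S i) y' * (cs * β₁ * 1 * Real.exp (-(δ * g.dist y y'))) + ind (S i) y * ind (S i) y' * (cd * β * 1 * Real.exp (-(δ * g.dist y y')))
        = ind (S i) y * ind (S i) y' * ((cs * β₁ + cd * β) * Real.exp (-(δ * g.dist y y'))) := by ring
      _ ≤ _ := key
  rw [comp_parametrix_of_leibniz hleib]
  refine (hasMaj_sum_overlap _ S _ Nov (fun y y' => mul_nonneg (by positivity) (Real.exp_nonneg _)) hterm hN).mono fun y y' => le_of_eq ?_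
  ring

/-- ★★ **THE RIGHT-DRESSED PARAMETRIX DECAYS**: cube entries `G_□∘E ≤ 1_S1_S·β₂e^{−δd}`, `G_□ ≤ 1_S1_S·βe^{−δd}`, partition letters as above ⟹ `G₀∘E ≤ N_ov·(β₂c_s + βc_d)·e^{−δd}`.
[cite: Balaban1984PropagatorsII, (2.133), (2.136) p.247 (shapes + mechanism)] -/
theorem hasMaj_parametrix_comp {E : (X → ℝ) →ₗ[ℝ] (X → ℝ)} {h hs dh : ι → X → ℝ} {G : ι → (X → ℝ) →ₗ[ℝ] (X → ℝ)} {β β₂ cs cd δ Nov : ℝ}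
    (hβ : 0 ≤ β) (hβ₂ : 0 ≤ β₂) (hcs : 0 ≤ cs) (hcd : 0 ≤ cd) (hleib : ∀ i, mulOp (h i) ∘ₗ E = E ∘ₗ mulOp (hs i) + mulOp (dh i))
    (hh : ∀ i x, |h i x| ≤ 1) (hhs : ∀ i x, |hs i x| ≤ cs) (hdh : ∀ i x, |dh i x| ≤ cd) (hN : ∀ a, ∑ i, ind (S i) a ≤ Nov)
    (hG : ∀ i, HasMaj (BlockNorm.ofBlocks g blk) (BlockNorm.ofBlocks g blk) (G i) (fun y y' => ind (S i) y * ind (S i) y' * (β * Real.exp (-(δ * g.dist y y')))))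
    (hGE : ∀ i, HasMaj (BlockNorm.ofBlocks g blk) (BlockNorm.ofBlocks g blk) (G i ∘ₗ E) (fun y y' => ind (S i) y * ind (S i) y' * (β₂ * Real.exp (-(δ * g.dist y y'))))) :
    HasMaj (BlockNorm.ofBlocks g blk) (BlockNorm.ofBlocks g blk) (parametrix h G ∘ₗ E) (fun y y' => Nov * (β₂ * cs + β * cd) * Real.exp (-(δ * g.dist y y'))) := by
  have hterm : ∀ i, HasMaj (BlockNorm.ofBlocks g blk) (BlockNorm.ofBlocks g blk) (mulOp (h i) ∘ₗ (G i ∘ₗ E) ∘ₗ mulOp (hs i) + mulOp (h i) ∘ₗ G i ∘ₗ mulOp (dh i))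
      (fun y y' => ind (S i) y * ((β₂ * cs + β * cd) * Real.exp (-(δ * g.dist y y')))) := fun i => by
    have t1 := hasMaj_sandwich_loc blk zero_le_one hcs hβ₂ (hh i) (hhs i) (hGE i)
    have t2 := hasMaj_sandwich_loc blk zero_le_one hcd hβ (hh i) (hdh i) (hG i)
    refine (t1.add t2).mono fun y y' => ?_
    have key := ind_mul_ind_le (Sc := S i) (A := (β₂ * cs + β * cd) * Real.exp (-(δ * g.dist y y'))) (mul_nonneg (by positivity) (Real.exp_nonneg _)) y y'
    calc ind (S i) y * ind (S i) y' * (1 * β₂ * cs * Real.exp (-(δ * g.dist y y'))) + ind (S i) y * ind (S i) y' * (1 * β * cd * Real.exp (-(δ * g.dist y y')))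
        = ind (S i) y * ind (S i) y' * ((β₂ * cs + β * cd) * Real.exp (-(δ * g.dist y y'))) := by ring
      _ ≤ _ := key
  rw [parametrix_comp_of_leibniz hleib]
  refine (hasMaj_sum_overlap _ S _ Nov (fun y y' => mul_nonneg (by positivity) (Real.exp_nonneg _)) hterm hN).mono fun y y' => le_of_eq ?_
  ring

end Majorants

/-! ## §3 η-defects of the dressed parametrices from cube entry defects and the partition's fits -/

section Defects

variable {X X' : Type} [Fintype X] [Fintype X'] {ι : Type} [Fintype ι] {g : B6.Geometry} (blk : X → g.Site) (π : X' → X) (S : ι → Set g.Site)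

/-- **LEIBNIZ FOR THE η-DEFECT OF A SANDWICH WITH GENERAL COEFFICIENT LETTERS**: fine letters `|a′| ≤ c_a`, coarse `|b| ≤ c_b`, fits `|a′ − a∘π| ≤ o_a`, `|b′ − b∘π| ≤ o_b`, cube letters
`T ≤ 1_S1_S·βe^{−δd}` (coarse), `T′ ≤ 1_S1_S·βe^{−δd}` (fine), `𝔇(T′,T) ≤ 1_S1_S·me^{−δd}` ⟹ `𝔇(M_{a′}T′M_{b′}, M_aTM_b) ≤ 1_S1_S·(c_aβo_b + c_amc_b + o_aβc_b)·e^{−δd}`. [folklore] -/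
theorem hasMaj_idef_sandwich_loc {T : (X → ℝ) →ₗ[ℝ] (X → ℝ)} {T' : (X' → ℝ) →ₗ[ℝ] (X' → ℝ)} {a b : X → ℝ} {a' b' : X' → ℝ} {Sc : Set g.Site} {ca cb oa ob β m δ : ℝ}
    (hca : 0 ≤ ca) (hcb : 0 ≤ cb) (hoa : 0 ≤ oa) (hob : 0 ≤ ob) (hβ : 0 ≤ β) (hm : 0 ≤ m) (ha' : ∀ x', |a' x'| ≤ ca) (hb : ∀ x, |b x| ≤ cb)
    (hfa : ∀ x', |a' x' - a (π x')| ≤ oa) (hfb : ∀ x', |b' x' - b (π x')| ≤ ob)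
    (hT : HasMaj (BlockNorm.ofBlocks g blk) (BlockNorm.ofBlocks g blk) T (fun y y' => ind Sc y * ind Sc y' * (β * Real.exp (-(δ * g.dist y y')))))
    (hT' : HasMaj (BlockNorm.ofBlocks g (blk ∘ π)) (BlockNorm.ofBlocks g (blk ∘ π)) T' (fun y y' => ind Sc y * ind Sc y' * (β * Real.exp (-(δ * g.dist y y')))))
    (hDT : HasMaj (BlockNorm.ofBlocks g blk) (BlockNorm.ofBlocks g (blk ∘ π)) (idef (pull π) (pull π) T' T) (fun y y' => ind Sc y * ind Sc y' * (m * Real.exp (-(δ * g.dist y y'))))) :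
    HasMaj (BlockNorm.ofBlocks g blk) (BlockNorm.ofBlocks g (blk ∘ π)) (idef (pull π) (pull π) (mulOp a' ∘ₗ T' ∘ₗ mulOp b') (mulOp a ∘ₗ T ∘ₗ mulOp b))
      (fun y y' => ind Sc y * ind Sc y' * ((ca * β * ob + ca * m * cb + oa * β * cb) * Real.exp (-(δ * g.dist y y')))) := by
  have hMa' := hasMaj_mulOp (g := g) (blk ∘ π) (m := fun _ => ca) (fun _ => hca) ha'
  have hMb := hasMaj_mulOp (g := g) blk (m := fun _ => cb) (fun _ => hcb) hb
  have hDa := hasMaj_idef_mulOp (g := g) blk π (o := fun _ => oa) (fun _ => hoa) hfa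
  have hDb := hasMaj_idef_mulOp (g := g) blk π (o := fun _ => ob) (fun _ => hob) hfb
  have hnn : ∀ (c : ℝ), 0 ≤ c → ∀ y y' : g.Site, 0 ≤ ind Sc y * ind Sc y' * (c * Real.exp (-(δ * g.dist y y'))) :=
    fun c hc y y' => mul_nonneg (mul_nonneg (ind_nonneg _ _) (ind_nonneg _ _)) (mul_nonneg hc (Real.exp_nonneg _))
  have t1 := hasMaj_diag_comp (blk ∘ π) (fun _ => hca) hMa' (hasMaj_comp_diag (blk ∘ π) (hnn β hβ) hT' hDb)
  have t2 := hasMaj_diag_comp (blk ∘ π) (fun _ => hca) hMa' (hasMaj_comp_diag blk (hnn m hm) hDT hMb)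
  have t3 := hasMaj_diag_comp blk (fun _ => hoa) hDa (hasMaj_comp_diag blk (hnn β hβ) hT hMb)
  rw [idef_sandwich]
  refine ((t1.add t2).add t3).mono fun y y' => le_of_eq ?_
  ring

/-- ★★ **THE η-DEFECT OF THE LEFT-DRESSED PARAMETRIX** from the cubes' entry defects `𝔇(D′G′_□, DG_□) ≤ 1·1·m₁e^{−δd}`, `𝔇(G′_□, G_□) ≤ 1·1·m₀e^{−δd}`, the entries' majorants (`β₁`, `β` at both
spacings) and the partition's letters∕fits (`|h^s′| ≤ c_s`, `|dh′| ≤ c_d`, `|h| ≤ 1`; fits `o_s`, `o_d`, `o`): `𝔇(D′∘G₀′, D∘G₀) ≤ N_ov·[(c_sβ₁o + c_sm₁ + o_sβ₁) + (c_dβo + c_dm₀ + o_dβ)]·e^{−δd}`.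
[cite: Balaban1984PropagatorsII, (2.133), (2.136) p.247 (shapes); Balaban1985BackgroundPropagators, Thm 3.14 pp.426–427 (difference template)] -/
theorem hasMaj_idef_comp_parametrix {D : (X → ℝ) →ₗ[ℝ] (X → ℝ)} {D' : (X' → ℝ) →ₗ[ℝ] (X' → ℝ)} {h hs dh : ι → X → ℝ} {h' hs' dh' : ι → X' → ℝ}
    {G : ι → (X → ℝ) →ₗ[ℝ] (X → ℝ)} {G' : ι → (X' → ℝ) →ₗ[ℝ] (X' → ℝ)} {β β₁ cs cd o os od m₀ m₁ δ Nov : ℝ} (hβ : 0 ≤ β) (hβ₁ : 0 ≤ β₁) (hcs : 0 ≤ cs) (hcd : 0 ≤ cd)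
    (ho : 0 ≤ o) (hos : 0 ≤ os) (hod : 0 ≤ od) (hm₀ : 0 ≤ m₀) (hm₁ : 0 ≤ m₁)
    (hleib : ∀ i, D ∘ₗ mulOp (h i) = mulOp (hs i) ∘ₗ D + mulOp (dh i)) (hleib' : ∀ i, D' ∘ₗ mulOp (h' i) = mulOp (hs' i) ∘ₗ D' + mulOp (dh' i))
    (hh : ∀ i x, |h i x| ≤ 1) (hhs' : ∀ i x', |hs' i x'| ≤ cs) (hdh' : ∀ i x', |dh' i x'| ≤ cd)
    (hfit : ∀ i x', |h' i x' - h i (π x')| ≤ o) (hfits : ∀ i x', |hs' i x' - hs i (π x')| ≤ os) (hfitd : ∀ i x', |dh' i x' - dh i (π x')| ≤ od)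
    (hN : ∀ a, ∑ i, ind (S i) a ≤ Nov)
    (hG : ∀ i, HasMaj (BlockNorm.ofBlocks g blk) (BlockNorm.ofBlocks g blk) (G i) (fun y y' => ind (S i) y * ind (S i) y' * (β * Real.exp (-(δ * g.dist y y')))))
    (hG' : ∀ i, HasMaj (BlockNorm.ofBlocks g (blk ∘ π)) (BlockNorm.ofBlocks g (blk ∘ π)) (G' i)
      (fun y y' => ind (S i) y * ind (S i) y' * (β * Real.exp (-(δ * g.dist y y')))))
    (hDG : ∀ i, HasMaj (BlockNorm.ofBlocks g blk) (BlockNorm.ofBlocks g blk) (D ∘ₗ G i) (fun y y' => ind (S i) y * ind (S i) y' * (β₁ * Real.exp (-(δ * g.dist y y')))))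
    (hDG' : ∀ i, HasMaj (BlockNorm.ofBlocks g (blk ∘ π)) (BlockNorm.ofBlocks g (blk ∘ π)) (D' ∘ₗ G' i)
      (fun y y' => ind (S i) y * ind (S i) y' * (β₁ * Real.exp (-(δ * g.dist y y')))))
    (hIG : ∀ i, HasMaj (BlockNorm.ofBlocks g blk) (BlockNorm.ofBlocks g (blk ∘ π)) (idef (pull π) (pull π) (G' i) (G i))
      (fun y y' => ind (S i) y * ind (S i) y' * (m₀ * Real.exp (-(δ * g.dist y y')))))
    (hIDG : ∀ i, HasMaj (BlockNorm.ofBlocks g blk) (BlockNorm.ofBlocks g (blk ∘ π)) (idef (pull π) (pull π) (D' ∘ₗ G' i) (D ∘ₗ G i))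
      (fun y y' => ind (S i) y * ind (S i) y' * (m₁ * Real.exp (-(δ * g.dist y y'))))) :
    HasMaj (BlockNorm.ofBlocks g blk) (BlockNorm.ofBlocks g (blk ∘ π)) (idef (pull π) (pull π) (D' ∘ₗ parametrix h' G') (D ∘ₗ parametrix h G))
      (fun y y' => Nov * ((cs * β₁ * o + cs * m₁ * 1 + os * β₁ * 1) + (cd * β * o + cd * m₀ * 1 + od * β * 1)) * Real.exp (-(δ * g.dist y y'))) := by
  have hterm : ∀ i, HasMaj (BlockNorm.ofBlocks g blk) (BlockNorm.ofBlocks g (blk ∘ π))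
      (idef (pull π) (pull π) (mulOp (hs' i) ∘ₗ (D' ∘ₗ G' i) ∘ₗ mulOp (h' i) + mulOp (dh' i) ∘ₗ G' i ∘ₗ mulOp (h' i))
        (mulOp (hs i) ∘ₗ (D ∘ₗ G i) ∘ₗ mulOp (h i) + mulOp (dh i) ∘ₗ G i ∘ₗ mulOp (h i)))
      (fun y y' => ind (S i) y * (((cs * β₁ * o + cs * m₁ * 1 + os * β₁ * 1) + (cd * β * o + cd * m₀ * 1 + od * β * 1)) * Real.exp (-(δ * g.dist y y')))) := fun i => by
    have t1 := hasMaj_idef_sandwich_loc blk π hcs zero_le_one hos ho hβ₁ hm₁ (hhs' i) (hh i) (hfits i) (hfit i) (hDG i) (hDG' i) (hIDG i)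
    have t2 := hasMaj_idef_sandwich_loc blk π hcd zero_le_one hod ho hβ hm₀ (hdh' i) (hh i) (hfitd i) (hfit i) (hG i) (hG' i) (hIG i)
    rw [idef_add]
    refine (t1.add t2).mono fun y y' => ?_
    have key := ind_mul_ind_le (Sc := S i) (A := ((cs * β₁ * o + cs * m₁ * 1 + os * β₁ * 1) + (cd * β * o + cd * m₀ * 1 + od * β * 1)) * Real.exp (-(δ * g.dist y y')))
      (mul_nonneg (by positivity) (Real.exp_nonneg _)) y y'
    calc ind (S i) y * ind (S i) y' * ((cs * β₁ * o + cs * m₁ * 1 + os * β₁ * 1) * Real.exp (-(δ * g.dist y y'))) +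
          ind (S i) y * ind (S i) y' * ((cd * β * o + cd * m₀ * 1 + od * β * 1) * Real.exp (-(δ * g.dist y y')))
        = ind (S i) y * ind (S i) y' * (((cs * β₁ * o + cs * m₁ * 1 + os * β₁ * 1) + (cd * β * o + cd * m₀ * 1 + od * β * 1)) * Real.exp (-(δ * g.dist y y'))) := by ring
      _ ≤ _ := key
  rw [comp_parametrix_of_leibniz hleib, comp_parametrix_of_leibniz hleib', idef_fsum]
  refine (hasMaj_sum_overlap _ S _ Nov (fun y y' => mul_nonneg (by positivity) (Real.exp_nonneg _)) hterm hN).mono fun y y' => le_of_eq ?_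
  ring

/-- ★★ **THE η-DEFECT OF THE RIGHT-DRESSED PARAMETRIX** from the cube entry-2 defects `𝔇(G′_□E′, G_□E) ≤ 1·1·m₂e^{−δd}`, entry-0 defects `m₀`, the entries' majorants (`β₂`, `β`) and the
partition's letters∕fits: `𝔇(G₀′∘E′, G₀∘E) ≤ N_ov·[(β₂o_s + m₂c_s + oβ₂c_s) + (βo_d + m₀c_d + oβc_d)]·e^{−δd}`.
[cite: Balaban1984PropagatorsII, (2.133), (2.136) p.247 (shapes); Balaban1985BackgroundPropagators, Thm 3.14 pp.426–427 (difference template)] -/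
theorem hasMaj_idef_parametrix_comp {E : (X → ℝ) →ₗ[ℝ] (X → ℝ)} {E' : (X' → ℝ) →ₗ[ℝ] (X' → ℝ)} {h hs dh : ι → X → ℝ} {h' hs' dh' : ι → X' → ℝ}
    {G : ι → (X → ℝ) →ₗ[ℝ] (X → ℝ)} {G' : ι → (X' → ℝ) →ₗ[ℝ] (X' → ℝ)} {β β₂ cs cd o os od m₀ m₂ δ Nov : ℝ} (hβ : 0 ≤ β) (hβ₂ : 0 ≤ β₂) (hcs : 0 ≤ cs) (hcd : 0 ≤ cd)
    (ho : 0 ≤ o) (hos : 0 ≤ os) (hod : 0 ≤ od) (hm₀ : 0 ≤ m₀) (hm₂ : 0 ≤ m₂)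
    (hleib : ∀ i, mulOp (h i) ∘ₗ E = E ∘ₗ mulOp (hs i) + mulOp (dh i)) (hleib' : ∀ i, mulOp (h' i) ∘ₗ E' = E' ∘ₗ mulOp (hs' i) + mulOp (dh' i))
    (hh' : ∀ i x', |h' i x'| ≤ 1) (hhs : ∀ i x, |hs i x| ≤ cs) (hdh : ∀ i x, |dh i x| ≤ cd)
    (hfit : ∀ i x', |h' i x' - h i (π x')| ≤ o) (hfits : ∀ i x', |hs' i x' - hs i (π x')| ≤ os) (hfitd : ∀ i x', |dh' i x' - dh i (π x')| ≤ od)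
    (hN : ∀ a, ∑ i, ind (S i) a ≤ Nov)
    (hG : ∀ i, HasMaj (BlockNorm.ofBlocks g blk) (BlockNorm.ofBlocks g blk) (G i) (fun y y' => ind (S i) y * ind (S i) y' * (β * Real.exp (-(δ * g.dist y y')))))
    (hG' : ∀ i, HasMaj (BlockNorm.ofBlocks g (blk ∘ π)) (BlockNorm.ofBlocks g (blk ∘ π)) (G' i)
      (fun y y' => ind (S i) y * ind (S i) y' * (β * Real.exp (-(δ * g.dist y y')))))
    (hGE : ∀ i, HasMaj (BlockNorm.ofBlocks g blk) (BlockNorm.ofBlocks g blk) (G i ∘ₗ E) (fun y y' => ind (S i) y * ind (S i) y' * (β₂ * Real.exp (-(δ * g.dist y y')))))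
    (hGE' : ∀ i, HasMaj (BlockNorm.ofBlocks g (blk ∘ π)) (BlockNorm.ofBlocks g (blk ∘ π)) (G' i ∘ₗ E')
      (fun y y' => ind (S i) y * ind (S i) y' * (β₂ * Real.exp (-(δ * g.dist y y')))))
    (hIG : ∀ i, HasMaj (BlockNorm.ofBlocks g blk) (BlockNorm.ofBlocks g (blk ∘ π)) (idef (pull π) (pull π) (G' i) (G i))
      (fun y y' => ind (S i) y * ind (S i) y' * (m₀ * Real.exp (-(δ * g.dist y y')))))
    (hIGE : ∀ i, HasMaj (BlockNorm.ofBlocks g blk) (BlockNorm.ofBlocks g (blk ∘ π)) (idef (pull π) (pull π) (G' i ∘ₗ E') (G i ∘ₗ E))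
      (fun y y' => ind (S i) y * ind (S i) y' * (m₂ * Real.exp (-(δ * g.dist y y'))))) :
    HasMaj (BlockNorm.ofBlocks g blk) (BlockNorm.ofBlocks g (blk ∘ π)) (idef (pull π) (pull π) (parametrix h' G' ∘ₗ E') (parametrix h G ∘ₗ E))
      (fun y y' => Nov * ((1 * β₂ * os + 1 * m₂ * cs + o * β₂ * cs) + (1 * β * od + 1 * m₀ * cd + o * β * cd)) * Real.exp (-(δ * g.dist y y'))) := by
  have hterm : ∀ i, HasMaj (BlockNorm.ofBlocks g blk) (BlockNorm.ofBlocks g (blk ∘ π))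
      (idef (pull π) (pull π) (mulOp (h' i) ∘ₗ (G' i ∘ₗ E') ∘ₗ mulOp (hs' i) + mulOp (h' i) ∘ₗ G' i ∘ₗ mulOp (dh' i))
        (mulOp (h i) ∘ₗ (G i ∘ₗ E) ∘ₗ mulOp (hs i) + mulOp (h i) ∘ₗ G i ∘ₗ mulOp (dh i)))
      (fun y y' => ind (S i) y * (((1 * β₂ * os + 1 * m₂ * cs + o * β₂ * cs) + (1 * β * od + 1 * m₀ * cd + o * β * cd)) * Real.exp (-(δ * g.dist y y')))) := fun i => by
    have t1 := hasMaj_idef_sandwich_loc blk π zero_le_one hcs ho hos hβ₂ hm₂ (hh' i) (hhs i) (hfit i) (hfits i) (hGE i) (hGE' i) (hIGE i)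
    have t2 := hasMaj_idef_sandwich_loc blk π zero_le_one hcd ho hod hβ hm₀ (hh' i) (hdh i) (hfit i) (hfitd i) (hG i) (hG' i) (hIG i)
    rw [idef_add]
    refine (t1.add t2).mono fun y y' => ?_
    have key := ind_mul_ind_le (Sc := S i) (A := ((1 * β₂ * os + 1 * m₂ * cs + o * β₂ * cs) + (1 * β * od + 1 * m₀ * cd + o * β * cd)) * Real.exp (-(δ * g.dist y y')))
      (mul_nonneg (by positivity) (Real.exp_nonneg _)) y y'
    calc ind (S i) y * ind (S i) y' * ((1 * β₂ * os + 1 * m₂ * cs + o * β₂ * cs) * Real.exp (-(δ * g.dist y y'))) +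
          ind (S i) y * ind (S i) y' * ((1 * β * od + 1 * m₀ * cd + o * β * cd) * Real.exp (-(δ * g.dist y y')))
        = ind (S i) y * ind (S i) y' * (((1 * β₂ * os + 1 * m₂ * cs + o * β₂ * cs) + (1 * β * od + 1 * m₀ * cd + o * β * cd)) * Real.exp (-(δ * g.dist y y'))) := by
          ring
      _ ≤ _ := key
  rw [parametrix_comp_of_leibniz hleib, parametrix_comp_of_leibniz hleib', idef_fsum]
  refine (hasMaj_sum_overlap _ S _ Nov (fun y y' => mul_nonneg (by positivity) (Real.exp_nonneg _)) hterm hN).mono fun y y' => le_of_eq ?_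
  ring

end Defects

end Summit.QuantumFields.YangMills.BalabanUVNodes.N15.Gluing

end
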